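import Literature.AlgebraicGeometry.Motives.MotivatedCyclesModelledOn
import Literature.AlgebraicGeometry.Motives.AbelianVariety
import Literature.AlgebraicGeometry.Motives.AbelianVarietyProjectiveChart
import Literature.AlgebraicGeometry.Motives.FamiliesVHS
import Literature.AlgebraicGeometry.Motives.BettiRealization
import HarnessLib

/-!
# The base pieces of André's Théorème 0.6.2: abelian varieties and compact abelian pencils

Y. André, *Pour une théorie inconditionnelle des motifs*, Publ. Math. IHÉS 83 (1996):

* Théorème 0.6.2 (p. 9), verbatim: «Tout cycle de Hodge `ξ` sur une variété abélienne `A`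
  est motivé. Plus précisément, `ξ` est somme de cycles de la forme `p_*(α ∪ ⋆_L(β))`, où `α`
  et `β` sont des `ℚ`-cycles algébriques sur `A × B × Y₁ × … × Y_k`, `B` désignant une variété
  abélienne, `Yᵢ` l'espace total d'un pinceau compact de variétés abéliennes, et `p` la
  projection sur `A`.»
* §6.3 (p. 31): «Le cas où `K = ℂ` et `𝒱` contient les pinceaux compacts de variétés
  abéliennes. Nous allons démontrer le théorème 0.6.2, à savoir que tout élément `ξ` de type
  `(0, 0)` dans `H²ᵖ_B(A, ℚ)(p)` est motivé», with footnote (2): a compact pencil of complex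
  abelian varieties is «un schéma abélien de base une courbe projective lisse sur `ℂ`»; the
  pencils are produced by Lemme 6.3.1 and Lemme 6.3.3 (linear sections of Baily–Borel
  compactified families of Hodge type, pp. 31–33) and the theorem follows from the deformation
  theorem 0.5 (p. 33).
* §6.3 Remarque 2 (p. 33): «Ce théorème ramène en particulier la conjecture de Hodge pour les
  variétés abéliennes à la question de savoir si l'involution de Lefschetz (ou de Hodge) sur
  les pinceaux compacts de variétés abéliennes est donnée par une correspondance algébrique.»
* §6.2 (p. 31): for `𝒱 = 𝒜b` «les cycles motivés modelés sur `𝒜b` sont algébriques»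
  (Lieberman: `⋆_L` is algebraic on abelian varieties).

This file names the class of base pieces of the sharp statement — the product closure
`abelianPencilPieces k` of the underlying varieties of abelian varieties and the total spaces
of compact pencils of abelian varieties (`IsCompactAbelianPencil`, rendered as in route
`ConservativityLefschetz` of the Hodge summit) — and states **Théorème 0.6.2 in its sharp
form as a predicate on a Betti–Hodge datum `B`**
(`Andre1996_hodgeClassesOnAbelianVarieties_motivatedModelledOn B`: every rational Hodge class
on a complex abelian variety is a motivated class of `B.W` modelled on `abelianPencilPieces ℂ`),
in the standing of the catalogued barrier predicate
`Literature.Barriers.HodgeConjecture.Andre1996_hodgeClassesOnAbelianVarieties_motivated B`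
(`Literature/Barriers/HodgeConjecture/MotivatedClassesAbelianVarieties.lean`, which allows every
smooth projective auxiliary variety and is implied by the present one,
`…motivatedModelledOn.hodgeClasses_le_motivatedClasses`). It then **proves Remarque 2 in typed
form** from `Motives/MotivatedCyclesModelledOn`: the sharp predicate together with conjecture
`B` (`θ`-form, all hyperplane classes) on the members of `abelianPencilPieces ℂ` — equivalently,
by stability of `B` under products (Kleiman 1968 §2; the tree's
`WeilCohomology.standardConjectureB_tensor_self` is the case `X × X`; not used here), on abelian varieties
(Lieberman; the tree's discharged `standardConjectureB_abelianVariety`) and on compact abelian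
pencils — gives the `B`-relative Hodge conjecture for every complex abelian variety in every
codimension (`…motivatedModelledOn.hodgeConjectureFor`).

## Why a predicate on `B` and not a named fact

Exactly as for the barrier predicate (its module docstring, section "v2", records the human
ruling of 2026-08-15): the theorem in print is the predicate AT the classical Betti–Hodge
realization («`K = ℂ`», Betti cohomology `H_B`, §6.3 p. 31), a datum the tree does not
construct (`BettiHodgeData` is a hypothesis structure); it is not a consequence of the fields
of an abstract `B`, and its closure over all `B` is untenable (the barrier file proves
`Andre1996_hodgeClassesOnAbelianVarieties_motivated_not_forall`; since the sharp predicate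
implies the coarse one, the same witnesses refute `∀ B, …motivatedModelledOn B`). So the binder
`B` is explicit, the declaration is a hypothesis schema used as `(h062 : … B)`, and no `_holds`
is owed.

## Main definitions

* `IsCompactAbelianPencil f d` (`f : Y ⟶ C` over a field `k`): `C` is a smooth projective
  curve, `Y` is smooth projective of dimension `d + 1`, `f` is a smooth projective family of
  relative dimension `d` admitting a section, and every rational fibre is isomorphic to (the
  underlying variety of) an abelian variety — the rendering of André's footnote used by route
  `ConservativityLefschetz` (items `AbelianPencilLefschetzB`, `AndreAbelianReduction`).
* `compactAbelianPencilSpaces k`, `abelianVarietySpaces k` : the total spaces of compact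
  abelian pencils, resp. the underlying varieties `A.X` of abelian varieties, as classes of
  `k`-schemes; `abelianPencilPieces k := prodClosure (abelianVarietySpaces k ∪ compactAbelianPencilSpaces k)`.
* `Andre1996_hodgeClassesOnAbelianVarieties_motivatedModelledOn (B : BettiHodgeData ℂ) : Prop`.

## Main statements (proved)

* `isProdClosed_abelianPencilPieces`, `AbelianVariety.X_mem_abelianPencilPieces`,
  `IsCompactAbelianPencil.mem_abelianPencilPieces`,
  `exists_isSmoothProjective_of_mem_abelianPencilPieces` (every piece is smooth projective).
* `Andre1996_hodgeClassesOnAbelianVarieties_motivatedModelledOn.hodgeClasses_le_motivatedClasses`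
  (sharp ⇒ coarse predicate).
* `Andre1996_hodgeClassesOnAbelianVarieties_motivatedModelledOn.hodgeConjectureFor` : **Remarque 2**,
  `Thm 0.6.2♯ ∧ HL ∧ B on abelianPencilPieces ℂ ⇒ ℚ·Aᵖ(A) = Hdgᵖ(A)` for every complex abelian
  variety; and the raw form `…hodgeConjectureFor_of_standardConjectureB_prod` with `B` asked
  only for the auxiliary products `A × Y`, `Y` a piece.

## Design choices and scope

* "Compact pencil of abelian varieties": André's footnote says abelian scheme over a smooth
  projective complex curve; the pencils the proof produces (Lemme 6.3.1, 6.3.3) are pull-backs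
  to complete curves of families of Hodge type, whose total spaces are smooth projective with
  abelian fibres and a zero section, i.e. they satisfy `IsCompactAbelianPencil`; conversely the
  data of `IsCompactAbelianPencil` are what the consumer's conjecture-`B` hypothesis is about.
  The predicate is stated over any field `k` (fibres over `k`-rational points); André's theorem
  concerns `k = ℂ`, where rational points are all closed points.
* The auxiliary varieties of the sharp predicate range over the whole product closure
  (`B × Y₁ × ⋯ × Y_k` in any bracketing and order, `k ≥ 0`, the factor `B` possibly absent),
  which contains André's `A × (B × Y₁ × ⋯ × Y_k)`-projections' auxiliaries; allowing more
  auxiliaries weakens the inclusion `Hdg ⊆ A_mot,𝒱`, so the printed theorem implies the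
  predicate at the classical datum (with the polarisation comparison recorded in
  `Motives/MotivatedCyclesModelledOn.lean`, Design choices), and the reduction (Remarque 2) is
  proved for the whole closure anyway.
* Hard Lefschetz for `B.W` is an explicit hypothesis of the reduction (André's standing
  assumption on the reference cohomology, p. 14; a theorem for Betti cohomology), since
  `BettiHodgeData` does not record it.
* Mathlib: no abelian schemes / pencils / motivated cycles (searched `AbelianScheme`, `pencil`,
  `motivated`); everything is built on the tree's `AbelianVariety`, `IsSmoothProjectiveFamily`,
  `fiberOver`, `AlgPoints`, `BettiHodgeData`, `WeilCohomology.motivatedClassesModelledOn`.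

## References

* Y. André, *Pour une théorie inconditionnelle des motifs*, Publ. Math. IHÉS 83 (1996), 5–49:
  Thm. 0.6.2 (p. 9), §6.1–6.3 (pp. 30–33: `𝒜b`, Lemme 6.3.1–6.3.3, footnote (2) p. 31,
  Remarques 1–2 p. 33), §0.3 (p. 7), §2.1 (p. 14). [Andre1996Motifs]
* S. Kleiman, *Algebraic cycles and the Weil conjectures* (1968), Prop. 2.3 (`B ⇒ ⋆` algebraic), §2
  (stability of `B` under products), Appendix 2A11 (Lieberman: `B` for abelian varieties), as cited by
  the tree's `StandardConjectures.lean`. [Kleiman1968AlgebraicCycles]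
* P. Deligne, *The Hodge conjecture* (Clay, 2000), §6 ("motivated"). [Deligne2000]
-/

universe u

open CategoryTheory AlgebraicGeometry MonoidalCategory CartesianMonoidalCategory
open scoped TensorProduct

noncomputable section

namespace Literature.AlgebraicGeometry.Motives

/-! ## Compact pencils of abelian varieties -/

section Pencils

variable {k : Type u} [Field k]

/-- `f : Y ⟶ C` **is a compact pencil of abelian varieties of relative dimension `d`** (André
1996 §6.3, footnote (2) p. 31: «un schéma abélien de base une courbe projective lisse», here
in the rendering of route `ConservativityLefschetz`): the base `C` is a smooth projective curve,
the total space `Y` is a smooth projective variety of dimension `d + 1`, `f` is a smooth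
projective family of relative dimension `d` (`IsSmoothProjectiveFamily`) admitting a section
(the zero section), and every fibre over a rational point is isomorphic, as a `k`-variety, to
the underlying variety of an abelian variety. [cite: Andre1996Motifs, §6.3 footnote (2) (p. 31) and Lemme 6.3.1] -/
structure IsCompactAbelianPencil {Y C : SchemeOver k} (f : Y ⟶ C) (d : ℕ) : Prop where
  /-- `f` has a section (the zero section of the abelian scheme). -/
  exists_section : ∃ e : C ⟶ Y, e ≫ f = 𝟙 C
  /-- The base is a smooth projective curve. -/
  isSmoothProjective_base : IsSmoothProjective 1 C
  /-- The total space is a smooth projective variety of dimension `d + 1`. -/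
  isSmoothProjective_total : IsSmoothProjective (d + 1) Y
  /-- `f` is a smooth projective family of relative dimension `d`. -/
  isSmoothProjectiveFamily : IsSmoothProjectiveFamily f d
  /-- Every rational fibre is (the variety underlying) an abelian variety. -/
  exists_abelianVariety_fiber : ∀ s : AlgPoints C k, ∃ A : AbelianVariety k, Nonempty (A.X ≅ fiberOver f s)

/-- Constructor from the unbundled data in which route `ConservativityLefschetz` quantifies
over compact abelian pencils (`f`, a section `e`, `e ≫ f = 𝟙 C`, smooth projectivity of `C`
and `Y`, `IsSmoothProjectiveFamily f d`, abelian rational fibres). [folklore] -/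
lemma IsCompactAbelianPencil.of_section {Y C : SchemeOver k} {f : Y ⟶ C} {d : ℕ} (e : C ⟶ Y)
    (he : e ≫ f = 𝟙 C) (hC : IsSmoothProjective 1 C) (hY : IsSmoothProjective (d + 1) Y)
    (hf : IsSmoothProjectiveFamily f d)
    (hA : ∀ s : AlgPoints C k, ∃ A : AbelianVariety k, Nonempty (A.X ≅ fiberOver f s)) :
    IsCompactAbelianPencil f d :=
  ⟨⟨e, he⟩, hC, hY, hf, hA⟩

/-- Every rational fibre of a compact abelian pencil is a smooth projective variety of
dimension `d` (from `IsSmoothProjectiveFamily`). [folklore] -/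
lemma IsCompactAbelianPencil.isSmoothProjective_fiberOver {Y C : SchemeOver k} {f : Y ⟶ C}
    {d : ℕ} (h : IsCompactAbelianPencil f d) (s : AlgPoints C k) :
    IsSmoothProjective d (fiberOver f s) :=
  h.isSmoothProjectiveFamily.isSmoothProjective s

variable (k) in
/-- The class of **total spaces of compact pencils of abelian varieties** over `k` (André 1996
Thm. 0.6.2: «`Yᵢ` l'espace total d'un pinceau compact de variétés abéliennes»).
[cite: Andre1996Motifs, Thm. 0.6.2 (p. 9) and §6.3 (p. 31)] -/
def compactAbelianPencilSpaces : Set (SchemeOver k) :=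
  {Y | ∃ (d : ℕ) (C : SchemeOver k) (f : Y ⟶ C), IsCompactAbelianPencil f d}

variable (k) in
/-- The class of the **underlying varieties `A.X` of abelian varieties** over `k` (André 1996
Thm. 0.6.2: «`B` désignant une variété abélienne»; cf. §6.1, p. 30, whose family `𝒜b`
consists of the `A ×_K K'`, `A` an abelian variety and `K'` «une `K`-algèbre de type fini»,
i.e. also twists by Artin motives / disjoint unions, which have no counterpart among the
geometrically integral varieties of this layer). [cite: Andre1996Motifs, Thm. 0.6.2 (p. 9) and §6.1 (p. 30)] -/
def abelianVarietySpaces : Set (SchemeOver k) :=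
  Set.range (AbelianVariety.X : AbelianVariety k → SchemeOver k)

variable (k) in
/-- **The base pieces of Théorème 0.6.2**: the smallest product-stable class of `k`-schemes
containing the underlying varieties of abelian varieties and the total spaces of compact
pencils of abelian varieties — the auxiliary varieties `B × Y₁ × ⋯ × Y_k` of André 1996
Thm. 0.6.2 (and the abelian variety `A` itself); §6.3 works with any class `𝒱` of base pieces
that «contient les pinceaux compacts de variétés abéliennes» (p. 31; and the abelian varieties,
§6.1), of which this is the smallest product-stable one. [cite: Andre1996Motifs, Thm. 0.6.2 (p. 9) and §6.3 (p. 31)] -/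
def abelianPencilPieces : Set (SchemeOver k) :=
  prodClosure (abelianVarietySpaces k ∪ compactAbelianPencilSpaces k)

/-- `abelianPencilPieces k` is stable under products. [folklore] -/
lemma isProdClosed_abelianPencilPieces : IsProdClosed (abelianPencilPieces k) :=
  isProdClosed_prodClosure _

/-- The underlying variety of an abelian variety is a base piece. [folklore] -/
lemma AbelianVariety.X_mem_abelianPencilPieces (A : AbelianVariety k) :
    A.X ∈ abelianPencilPieces k :=
  subset_prodClosure _ (Or.inl ⟨A, rfl⟩)

/-- The total space of a compact abelian pencil is a base piece. [folklore] -/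
lemma IsCompactAbelianPencil.mem_abelianPencilPieces {Y C : SchemeOver k} {f : Y ⟶ C} {d : ℕ}
    (h : IsCompactAbelianPencil f d) : Y ∈ abelianPencilPieces k :=
  subset_prodClosure _ (Or.inr ⟨d, C, f, h⟩)

/-- Products of base pieces are base pieces (e.g. `A.X ⊗ Y` for a pencil `Y`). [folklore] -/
lemma tensor_mem_abelianPencilPieces {Y Z : SchemeOver k} (hY : Y ∈ abelianPencilPieces k)
    (hZ : Z ∈ abelianPencilPieces k) : Y ⊗ Z ∈ abelianPencilPieces k :=
  isProdClosed_abelianPencilPieces hY hZ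

/-- Every base piece is a smooth projective variety of some dimension: abelian varieties by
the discharged fact `AbelianVariety.isSmoothProjective_holds`, pencil spaces by definition,
products by `IsSmoothProjective.tensor`. [folklore] -/
lemma exists_isSmoothProjective_of_mem_abelianPencilPieces {Y : SchemeOver k}
    (hY : Y ∈ abelianPencilPieces k) : ∃ m, IsSmoothProjective m Y := by
  refine exists_isSmoothProjective_of_mem_prodClosure ?_ hY
  rintro Z (⟨A, rfl⟩ | ⟨d, C, f, hf⟩)
  · exact ⟨A.dim, AbelianVariety.isSmoothProjective_holds⟩
  · exact ⟨d + 1, hf.isSmoothProjective_total⟩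

end Pencils

/-! ## Théorème 0.6.2, sharp form, as a predicate on the Betti–Hodge datum -/

section Andre062

/-- **André (1996), Théorème 0.6.2 in its sharp ("plus précisément") form, as a PREDICATE on
the Betti–Hodge datum `B`** — a hypothesis schema ("Theorem 0.6.2♯ holds for the Hodge
structures and the Weil cohomology OF `B`"), NOT a named fact awaiting a discharge (module
docstring, "Why a predicate"). For every complex abelian variety `A` (smooth-projectivity
witness `hA`, always available as `AbelianVariety.isSmoothProjective_holds`) and every `p`,
every rational Hodge class of `B` in `H²ᵖ(A, ℚ)` lies in the span of the motivated classes of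
`B.W` **modelled on `abelianPencilPieces ℂ`**: classes `pr_{A*}(α ∪ ⋆β)` with `α`, `β` rational
algebraic on `A × Y`, `Y` a product of (underlying varieties of) abelian varieties and total
spaces of compact pencils of abelian varieties, `⋆` the Lefschetz involution of `A × Y` for a
hyperplane class — «`ξ` est somme de cycles de la forme `p_*(α ∪ ⋆_L(β))`, où `α` et `β` sont
des `ℚ`-cycles algébriques sur `A × B × Y₁ × … × Y_k`». The theorem in print is this predicate
AT the classical Betti–Hodge realization («`K = ℂ`», `H_B`, §6.3 p. 31), which the tree does
not construct; the coarse predicate with arbitrary smooth projective auxiliaries is the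
catalogued barrier `Literature.Barriers.HodgeConjecture.Andre1996_hodgeClassesOnAbelianVarieties_motivated B`,
implied by this one (`…hodgeClasses_le_motivatedClasses`). Scope: only `K = ℂ` is rendered
(André: any `K ⊆ ℂ`, and Remarque 1 p. 33 for absolute Hodge cycles); the auxiliary class is
the full product closure (weaker inclusion than the printed `B × Y₁ × ⋯ × Y_k`, hence implied
by it); polarisations as in `WeilCohomology.IsMotivatedClassModelledOn`.
[cite: Andre1996Motifs, Thm. 0.6.2 (p. 9) and §6.3 (pp. 31–33)] -/
def Andre1996_hodgeClassesOnAbelianVarieties_motivatedModelledOn (B : BettiHodgeData ℂ) : Prop :=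
  ∀ (A : AbelianVariety ℂ) (hA : IsSmoothProjective A.dim A.X) (p : ℕ),
    (B.hodge hA (2 * p)).hodgeClasses p ≤
      B.W.motivatedClassesModelledOn (abelianPencilPieces ℂ) A.dim A.X p

variable {B : BettiHodgeData ℂ}

/-- Unfolding: under Thm. 0.6.2♯ a rational Hodge class on a complex abelian variety lies in
the span of the motivated classes modelled on `abelianPencilPieces ℂ`. [cite: Andre1996Motifs, Thm. 0.6.2 (p. 9)] -/
theorem Andre1996_hodgeClassesOnAbelianVarieties_motivatedModelledOn.mem_motivatedClassesModelledOn
    (h062 : Andre1996_hodgeClassesOnAbelianVarieties_motivatedModelledOn B) {A : AbelianVariety ℂ}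
    (hA : IsSmoothProjective A.dim A.X) {p : ℕ} {x : B.W.obj A.X (2 * p)}
    (hx : x ∈ (B.hodge hA (2 * p)).hodgeClasses p) :
    x ∈ B.W.motivatedClassesModelledOn (abelianPencilPieces ℂ) A.dim A.X p :=
  h062 A hA p hx

/-- **Sharp implies coarse**: under Thm. 0.6.2♯, Hodge classes on complex abelian varieties are
motivated classes of `B.W` in the tree's sense (all smooth projective auxiliaries) — the body
of the barrier predicate `Literature.Barriers.HodgeConjecture.Andre1996_hodgeClassesOnAbelianVarieties_motivated B`.
[cite: Andre1996Motifs, Thm. 0.6.2 (p. 9)] -/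
theorem Andre1996_hodgeClassesOnAbelianVarieties_motivatedModelledOn.hodgeClasses_le_motivatedClasses
    (h062 : Andre1996_hodgeClassesOnAbelianVarieties_motivatedModelledOn B) (A : AbelianVariety ℂ)
    (hA : IsSmoothProjective A.dim A.X) (p : ℕ) :
    (B.hodge hA (2 * p)).hodgeClasses p ≤ B.W.motivatedClasses A.dim A.X p :=
  (h062 A hA p).trans (WeilCohomology.motivatedClassesModelledOn_le_motivatedClasses p)

/-- **Remarque 2 (André 1996, p. 33) in typed form, raw version.** Under Thm. 0.6.2♯ and hard
Lefschetz for `B.W`, if Grothendieck's standard conjecture of Lefschetz type holds in `θ`-form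
for every hyperplane class of every auxiliary product `A × Y`, `Y ∈ abelianPencilPieces ℂ`
(smooth projective of dimension `m`), then the `B`-relative Hodge conjecture
`ℚ·Aᵖ(A) = Hdgᵖ(A)` holds for the complex abelian variety `A` in every codimension `p`:
`Hdgᵖ(A) ⊆ A_mot^p(A)_𝒱 ⊆ Aᵖ(A)` by
`WeilCohomology.motivatedClassesModelledOn_le_algebraicClasses` («`A_mot(X) = A(X)` si …
l'involution de Lefschetz est donnée par une correspondance algébrique», §2.1 p. 14).
[cite: Andre1996Motifs, §6.3 Remarque 2 (p. 33) and §2.1 (p. 14)] -/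
theorem Andre1996_hodgeClassesOnAbelianVarieties_motivatedModelledOn.hodgeConjectureFor_of_standardConjectureB_prod
    (h062 : Andre1996_hodgeClassesOnAbelianVarieties_motivatedModelledOn B)
    (hL : B.W.HasHardLefschetz) (A : AbelianVariety ℂ) (hA : IsSmoothProjective A.dim A.X)
    (hB : ∀ ⦃m : ℕ⦄ ⦃Y : SchemeOver ℂ⦄, Y ∈ abelianPencilPieces ℂ → IsSmoothProjective m Y →
      ∀ ⦃η : B.W.obj (A.X ⊗ Y) 2⦄, B.W.IsHyperplaneClass (A.X ⊗ Y) η →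
        B.W.StandardConjectureB (A.dim + m) (A.X ⊗ Y) η)
    (p : ℕ) : B.HodgeConjectureFor hA p := by
  rw [BettiHodgeData.hodgeConjectureFor_iff]
  exact (h062 A hA p).trans (WeilCohomology.motivatedClassesModelledOn_le_algebraicClasses hL hB hA p)

/-- **Remarque 2 (André 1996, p. 33) in typed form**: «Ce théorème ramène en particulier la
conjecture de Hodge pour les variétés abéliennes à la question de savoir si l'involution de
Lefschetz … sur les pinceaux compacts de variétés abéliennes est donnée par une correspondance
algébrique.» Under Thm. 0.6.2♯ and hard Lefschetz for `B.W`, if Grothendieck's `B` (`θ`-form,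
every hyperplane class) holds for every member of `abelianPencilPieces ℂ` — the product-stable
class generated by abelian varieties, for which `B` is Lieberman's theorem (the tree's
discharged `standardConjectureB_abelianVariety`), and by the compact abelian pencils — then the
`B`-relative Hodge conjecture holds for every complex abelian variety in every codimension.
(`B` for products follows from `B` for the factors, Kleiman 1968 §2, cf. the tree's
`WeilCohomology.standardConjectureB_tensor_self` for `X × X`; that step is not taken here, the
hypothesis being on the closure.) [cite: Andre1996Motifs, §6.3 Remarque 2 (p. 33)] -/
theorem Andre1996_hodgeClassesOnAbelianVarieties_motivatedModelledOn.hodgeConjectureFor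
    (h062 : Andre1996_hodgeClassesOnAbelianVarieties_motivatedModelledOn B)
    (hL : B.W.HasHardLefschetz)
    (hB : ∀ ⦃m : ℕ⦄ ⦃Z : SchemeOver ℂ⦄, Z ∈ abelianPencilPieces ℂ → IsSmoothProjective m Z →
      ∀ ⦃η : B.W.obj Z 2⦄, B.W.IsHyperplaneClass Z η → B.W.StandardConjectureB m Z η)
    (A : AbelianVariety ℂ) (hA : IsSmoothProjective A.dim A.X) (p : ℕ) :
    B.HodgeConjectureFor hA p := by
  rw [BettiHodgeData.hodgeConjectureFor_iff]
  exact (h062 A hA p).trans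
    (WeilCohomology.motivatedClassesModelledOn_le_algebraicClasses_of_isProdClosed hL
      isProdClosed_abelianPencilPieces hB A.X_mem_abelianPencilPieces hA p)

end Andre062

end Literature.AlgebraicGeometry.Motives

end
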